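import Summits.AnomalousDissipation.AnomalousDissipation.Theorems.SolenoidalFractalHomogenisationLagrangianStepSidebandXSlowAveraging
import Literature.Analysis.ODE.LinearPeriodicAveragingForcedWeighted
import HarnessLib

/-!
# K1L_D `LagrangianRenormalisationStepDesign` (stmt-AnomalousDissipation-27980), `stub_D1_V0R` (D27-1; V0 = clause (ii) of
# `WCrossing.D1ExactFamily`), brick T6″ applied: THE SLOW MODE IS AVERAGED with the forcing in the WEIGHTED `L¹` norm —
# `‖x t − exp(−tḠ) x 0‖ ≤ M·L P₁(1 + (2‖Ḡ‖+L)/r_lo) + (1 + L P₁)·∫₀ᵗ e^{−r_lo(t−s)}‖slowForcing s‖ ds`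
# (helper; `--kind proof --supports stmt-AnomalousDissipation-27980 --as helper`)

Summits-side helper file of route `SolenoidalFractalHomogenisation` (prover seat `ad-k1l-cellLawV-w1` g7; 0 sorry, no defs, no named facts).  Same as
`…SidebandXSlowAveraging.norm_modeRep_sub_exp_le` but through `Literature.Analysis.ODE.PeriodicAveraging.norm_sub_exp_apply_le_forced_weighted`: the
forcing `slowForcing` (= `−Σⱼ ξⱼ P_ℓ fbⱼ (r + (projX y − y))`) has a LARGE but FAST-DECAYING initial layer (`r 0 = −projX y 0`, ‖r 0‖ ≈ (ξ/ν)‖x₀‖,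
decay rate ≈ ν ≫ r_lo ≈ ξ²/ν), for which the supremum bound of T6 is `O(1)` relative while the weighted `L¹` bound is `O(ξ²/ν²)` (cell STATUS
2026-08-29, w1 g7 «REFINEMENT NEEDED»).  Coercivity of `Ḡ` stays a hypothesis (supplied by `…SidebandXEffGen.effGenC_coercive` once the effective
tensor's `NearIso` window is known — finding F-w1g7-1 / ruling D27-1).
* **`norm_modeRep_sub_exp_le_weighted`**.
NOT a proof of any registered stub, of K1L_D, or of anomalous dissipation; rung F-D1.A0 infrastructure.
-/

set_option linter.dupNamespace false

noncomputable section

namespace Summit.AnomalousDissipation.AnomalousDissipation.Theorems.SolenoidalFractalHomogenisation.LagrangianStep.Sideband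

open Set MeasureTheory Complex UnitAddTorus Filter Topology intervalIntegral NormedSpace
open scoped InnerProductSpace
open Literature.Analysis Literature.Analysis.FunctionSpaces Literature.Analysis.FunctionSpaces.Torus
open Literature.Analysis.FluidPDE Literature.Analysis.FluidPDE.Torus Literature.Analysis.FluidPDE.LatticeShear
open Literature.Analysis.ODE.PeriodicAveraging (norm_sub_exp_apply_le_forced_weighted)
open Summit.AnomalousDissipation.AnomalousDissipation.Theorems.SolenoidalFractalHomogenisation.LagrangianStep.CellChain
  (modeRep continuousOn_modeRep)
open Summit.AnomalousDissipation.AnomalousDissipation.Theorems.SolenoidalFractalHomogenisation.PermissibleCarrier (period_pos)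

variable {k₀ : ℕ}

/-- **THE SLOW MODE IS AVERAGED, WEIGHTED-`L¹` FORCING (T6″)**: let `Ḡ : ℂ³ →L[ℝ] ℂ³` satisfy `Ḡ v = 4π²P_ℓT_{𝔹ᵀ}(ℓ) v + slowMean v` on `ℓ`-transversal
`v` (`𝔹 = (1/n²)•𝔸`), be coercive (`r_lo‖v‖² ≤ ⟪Ḡv, v⟫_ℝ`, `r_lo > 0`) with `‖Ḡ‖ ≤ Gn`; let `‖x s‖ ≤ M` on `[0,t] ⊆ [0,T]`.  Then, with `L := 2ξ²C_fC_N`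
and `P₁ := W₁.period`,  `‖x t − exp(−tḠ)(x 0)‖ ≤ M·L P₁(1 + (2Gn + L)/r_lo) + (1 + L P₁)·∫₀ᵗ e^{−r_lo(t−s)}‖slowForcing s‖ ds`.
[cite: SandersVerhulstMurdock2007, Theorem 2.8.1 and Theorem 5.5.1, inhomogeneous linear case] [cite: MajdaKramer1999, §2.2.1.3 (55)] -/
theorem norm_modeRep_sub_exp_le_weighted (W₁ : LatticeWord k₀) {n : ℕ} {T : ℝ} {𝔸 : Torus.Visc4 (Fin 3)} {lo hi : ℝ}
    (h𝔸 : Torus.NearIso 𝔸 lo hi) (hlo : 0 < lo)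
    {F : UnitAddTorus (Fin 3) → EuclideanSpace ℝ (Fin 3)} {w : ℝ → UnitAddTorus (Fin 3) → EuclideanSpace ℝ (Fin 3)}
    (h : Torus.IsWeakTensorPassiveVectorOn 0 T ((1 / (n : ℝ) ^ 2) • 𝔸) (W₁.cell n) F w) (hF : Integrable F volume) {ℓ : Fin 3 → ℤ}
    {R : ℕ} (hbox : ∀ j, (W₁.phase j).m ∈ box R)
    (G : EuclideanSpace ℂ (Fin 3) →L[ℝ] EuclideanSpace ℂ (Fin 3)) {rlo Gn M : ℝ} (hrlo : 0 < rlo)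
    (hcoer : ∀ v : EuclideanSpace ℂ (Fin 3), rlo * ‖v‖ ^ 2 ≤ ⟪G v, v⟫_ℝ) (hGn : ‖G‖ ≤ Gn)
    (hGx : ∀ v : EuclideanSpace ℂ (Fin 3), transversalProj ℓ v = v →
      G v = (((4 * Real.pi ^ 2 : ℝ) : ℂ)) • transversalProj ℓ (Torus.symbT (Torus.majorTranspose ((1 / (n : ℝ) ^ 2) • 𝔸)) ℓ v) +
        slowMean W₁ n ℓ 𝔸 R v)
    {t : ℝ} (ht : t ∈ Icc 0 T)
    (hM : ∀ s ∈ Icc 0 t, ‖modeRep W₁ n ((1 / (n : ℝ) ^ 2) • 𝔸) F w ℓ s‖ ≤ M) :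
    ‖modeRep W₁ n ((1 / (n : ℝ) ^ 2) • 𝔸) F w ℓ t - exp (-(t • G)) (modeRep W₁ n ((1 / (n : ℝ) ^ 2) • 𝔸) F w ℓ 0)‖ ≤
      M * (2 * ((Real.sqrt (freqNormSq ℓ) / n) ^ 2 * (∑ j, 4 * Real.pi * ‖slotAmp W₁ j‖) *
            (∑ j, 8 * Real.pi * ‖slotAmp W₁ j‖ / min 1 (4 * Real.pi ^ 2 * lo))) * W₁.period *
          (1 + (2 * Gn + 2 * ((Real.sqrt (freqNormSq ℓ) / n) ^ 2 * (∑ j, 4 * Real.pi * ‖slotAmp W₁ j‖) *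
            (∑ j, 8 * Real.pi * ‖slotAmp W₁ j‖ / min 1 (4 * Real.pi ^ 2 * lo)))) / rlo)) +
      (1 + 2 * ((Real.sqrt (freqNormSq ℓ) / n) ^ 2 * (∑ j, 4 * Real.pi * ‖slotAmp W₁ j‖) *
            (∑ j, 8 * Real.pi * ‖slotAmp W₁ j‖ / min 1 (4 * Real.pi ^ 2 * lo))) * W₁.period) *
        ∫ s in (0:ℝ)..t, Real.exp (-(rlo * (t - s))) * ‖slowForcing W₁ n ℓ 𝔸 R F w s‖ := by
  have hT : 0 ≤ T := ht.1.trans ht.2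
  have hP := period_pos W₁
  have hg : Continuous fun s => slowPert W₁ n ℓ 𝔸 R s - slowMean W₁ n ℓ 𝔸 R :=
    (continuous_slowPert W₁ n ℓ h𝔸 hlo R).sub continuous_const
  have hxc : ContinuousOn (modeRep W₁ n ((1 / (n : ℝ) ^ 2) • 𝔸) F w ℓ) (Icc 0 t) :=
    (continuousOn_modeRep W₁ n hT h ℓ).mono (Icc_subset_Icc_right ht.2)
  have hρc : ContinuousOn (slowForcing W₁ n ℓ 𝔸 R F w) (Icc 0 t) :=
    (continuousOn_slowForcing W₁ ℓ h𝔸 hlo R hT h).mono (Icc_subset_Icc_right ht.2)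
  have hL : ∀ s ∈ Icc 0 t, ‖slowPert W₁ n ℓ 𝔸 R s - slowMean W₁ n ℓ 𝔸 R‖ ≤ 2 * ((Real.sqrt (freqNormSq ℓ) / n) ^ 2 *
      (∑ j, 4 * Real.pi * ‖slotAmp W₁ j‖) * (∑ j, 8 * Real.pi * ‖slotAmp W₁ j‖ / min 1 (4 * Real.pi ^ 2 * lo))) :=
    fun s _ => norm_slowPert_sub_slowMean_le W₁ n ℓ h𝔸 hlo R s
  have hmean : ∀ k : ℕ, ((k : ℝ) + 1) * W₁.period ≤ t →
      ‖∫ s in ((k : ℝ) * W₁.period)..(((k : ℝ) + 1) * W₁.period), (slowPert W₁ n ℓ 𝔸 R s - slowMean W₁ n ℓ 𝔸 R)‖ ≤ 0 * W₁.period := by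
    intro k _
    rw [integral_slowPert_sub_slowMean_window W₁ n ℓ h𝔸 hlo R k, norm_zero, zero_mul]
  have hx : ∀ s ∈ Ioo 0 t, HasDerivAt (modeRep W₁ n ((1 / (n : ℝ) ^ 2) • 𝔸) F w ℓ)
      (-(G (modeRep W₁ n ((1 / (n : ℝ) ^ 2) • 𝔸) F w ℓ s) +
          (slowPert W₁ n ℓ 𝔸 R s - slowMean W₁ n ℓ 𝔸 R) (modeRep W₁ n ((1 / (n : ℝ) ^ 2) • 𝔸) F w ℓ s)) +
        slowForcing W₁ n ℓ 𝔸 R F w s) s := by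
    intro s hs
    have hsT : s ∈ Ioo 0 T := ⟨hs.1, hs.2.trans_le ht.2⟩
    have htr : transversalProj ℓ (modeRep W₁ n ((1 / (n : ℝ) ^ 2) • 𝔸) F w ℓ s) = modeRep W₁ n ((1 / (n : ℝ) ^ 2) • 𝔸) F w ℓ s :=
      transversalProj_modeRep W₁ n hT h ℓ ⟨hs.1.le, hsT.2.le⟩
    refine (hasDerivAt_slow_forced W₁ n h hF ℓ hbox hsT).congr_deriv ?_
    rw [hGx _ htr, sub_apply]
    abel
  have hmain := norm_sub_exp_apply_le_forced_weighted G hg (modeRep W₁ n ((1 / (n : ℝ) ^ 2) • 𝔸) F w ℓ) hrlo hP le_rfl ht.1 hcoer hGn hL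
    hmean hxc hρc hx hM
  simpa only [zero_mul, zero_add] using hmain

end Summit.AnomalousDissipation.AnomalousDissipation.Theorems.SolenoidalFractalHomogenisation.LagrangianStep.Sideband

end
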